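import Summits.CriticalPhenomena.PercolationContinuityZ3.Theorems.PercNearOneGluingNoHeavyPcintMemCertZ4T8
import Summits.CriticalPhenomena.PercolationContinuityZ3.Theorems.PercNearOneGluingNoHeavyPcintClosingOctagonsZ4
import HarnessLib

/-!
# CriticalPhenomena/PercolationContinuityZ3 — Theorems/PercNearOneGluingNoHeavyPcintLoopExclusionRungEightZ4.lean: the THIRD rung of C4 on `ℤ⁴` — `0 < R_8(ℤ⁴) ≤ 0.65 < 0.68 ≤ R_6(ℤ⁴)`

Lane prim-pcint, STRUCTURE rule.  With the two-sided memory-8 certificate of `ℤ⁴` (`Δ_8(ℤ⁴) ≤ 0.00307`, …MemCertZ4T8), the memory-6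
certificate (`μ_6(ℤ⁴) ≤ 6.8512177`, …RungSixZ4) and the octagon count `2·8·p_8(ℤ⁴) ≥ 22944` (…ClosingOctagonsZ4):
`f_8(ℤ⁴) ≥ 22944/6.8512177⁸ ≈ 0.0047263` (`memLoopDensity_eight_zd4_ge`), **`loopCompat_eight_zd4_le : R_8(ℤ⁴) ≤ 0.65`** (measured
0.6472), hence **`loopCompat_eight_lt_six_zd4 : R_8(ℤ⁴) < R_6(ℤ⁴)`** (clause (c) at `(4, 3)`; `R_6(ℤ⁴) ≥ 0.68`), **`loopCompatWindow_four_four`**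
(clause (a) at `(4, 4)`) and **`loopCompat_chain_zd4 : R_8(ℤ⁴) < R_6(ℤ⁴) < R_4(ℤ⁴)`**.  Together with `loopCompat_chain_zd3`: the factor table
of the typed law C4 is certified at every `(d, τ) ∈ {3, 4} × {4, 6, 8}`.

HONEST FRAMING: elementary consequences of kernel certificates; nothing here is used by a certified `p_c` cell.  Written by prim-pcint-2
gen 17 (prover-prim-pcint-2-g17-0), 2026-08-25.
-/

noncomputable section

open Literature.Probability.LatticeModels Literature.Probability.Percolation
open Summit.CriticalPhenomena.PercolationContinuityZ3.Theorems.Pcint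

namespace Summit.CriticalPhenomena.PercolationContinuityZ3.Theorems.Pcint.MemoryTail

/-- **`f_8(ℤ⁴) ≥ 22944/6.8512177⁸`** (`≈ 0.0047263`). [this work] -/
theorem memLoopDensity_eight_zd4_ge : (22944 : ℝ) / 6.8512177 ^ 8 ≤ memLoopDensity 4 8 := by
  unfold memLoopDensity
  rw [show (8 : ℕ) - 2 = 6 from rfl]
  have hμlo : (6.8512133 : ℝ) ≤ memGrowth 4 6 := le_trans (by norm_num) memGrowth_six_zd4_ge
  have hμhi : memGrowth 4 6 ≤ 6.8512177 := le_trans memGrowth_six_zd4_le (by norm_num)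
  have hμpos : (0 : ℝ) < memGrowth 4 6 := by linarith
  have hcc : (22944 : ℝ) ≤ ((closingCount 4 8 : ℕ) : ℝ) := by exact_mod_cast closingCount_eight_zd4_ge
  exact div_le_div₀ (le_trans (by norm_num) hcc) hcc (by positivity) (pow_le_pow_left₀ hμpos.le hμhi 8)

/-- `f_8(ℤ⁴) > 0`. [this work] -/
theorem memLoopDensity_eight_zd4_pos : 0 < memLoopDensity 4 8 :=
  lt_of_lt_of_le (by norm_num) memLoopDensity_eight_zd4_ge

/-- **`R_8(ℤ⁴) ≤ 0.65`** (measured 0.6472). [this work] -/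
theorem loopCompat_eight_zd4_le : loopCompat 4 8 ≤ 0.65 := by
  unfold loopCompat
  have hf := memLoopDensity_eight_zd4_ge
  have hfpos := memLoopDensity_eight_zd4_pos
  have hΔ := memLoopCost_eight_zd4_bounds.2
  rw [div_le_iff₀ hfpos]
  have : (0.00307 : ℝ) ≤ 0.65 * ((22944 : ℝ) / 6.8512177 ^ 8) := by norm_num
  nlinarith

/-- **`R_8(ℤ⁴) < R_6(ℤ⁴)`**: clause (c) of C4 at `(d, m) = (4, 3)`. [this work] -/
theorem loopCompat_eight_lt_six_zd4 : loopCompat 4 8 < loopCompat 4 6 :=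
  lt_of_le_of_lt loopCompat_eight_zd4_le (lt_of_lt_of_le (by norm_num) loopCompat_six_zd4_ge)

/-- `loopCompatStrictAntiMemory` at `(4, 3)`. [this work] -/
theorem loopCompatStrictAntiMemory_four_three : loopCompat 4 (2 * 3 + 2) < loopCompat 4 (2 * 3) :=
  loopCompat_eight_lt_six_zd4

/-- `loopCompatWindow` at `(4, 4)`: `0 < R_8(ℤ⁴) < 1`. [this work] -/
theorem loopCompatWindow_four_four : 0 < loopCompat 4 (2 * 4) ∧ loopCompat 4 (2 * 4) < 1 :=
  ⟨loopCompat_eight_zd4_pos, lt_of_le_of_lt loopCompat_eight_zd4_le (by norm_num)⟩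

/-- **The first three rungs of `ℤ⁴` are strictly ordered: `R_8(ℤ⁴) < R_6(ℤ⁴) < R_4(ℤ⁴)`.** [this work] -/
theorem loopCompat_chain_zd4 : loopCompat 4 8 < loopCompat 4 6 ∧ loopCompat 4 6 < loopCompat 4 4 :=
  ⟨loopCompat_eight_lt_six_zd4, loopCompat_six_lt_four_zd4⟩

end Summit.CriticalPhenomena.PercolationContinuityZ3.Theorems.Pcint.MemoryTail
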